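import Literature.Computability.Cryptography.HILLGreedyLaws
import HarnessLib

/-!
# HILL Lemma 6.3.2, claim (a): after `k` stages the two samplers are statistically close (Håstad–Impagliazzo–Levin–Luby 1999, §6.3)

> **(a)** `E[δ^{(kₙ)}] ≤ 2^{−n}`. … The entropy of the input to `h'` conditional on the rest of the bits of
> `𝒟^{(kₙ)}` is at least `Σ_j c_j`. So, if this sum is at least `mₙ + kₙ^{2/3}`, applying Lemma 4.5.1 [the
> Leftover Hash Lemma], `L₁(𝒟^{(kₙ)}, ℰ^{(kₙ)}) ≤ 2^{−n}`. [HILL 1999, Lemma 6.3.2, proof of (a)]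

This file proves the quantitative core for the concrete samplers of `HILLGreedySamplers`: for a template `τ`
whose positions fixed with `c_j = 1` carry at least `m + 2N + 2` hidden uniform bits
(`K·#C1(τ) ≥ mlen + 2N + 2`, `K = ⌊log₂ N⌋` bits per position),
`|δ^{(τ)}| = |Pr[A(𝒟^{(τ)}) = 1] − Pr[A(ℰ^{(τ)}) = 1]| ≤ 2^{−N−2}` (`abs_delta_le_of_hidden`), by the
generalized Leftover Hash Lemma in test form (`LeftoverHash.leftoverHash_cond_minEntropy_test`, Dodis et al.
2008 Lemma 2.4) with side information "every coin except the hidden blocks" — under which the hash input is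
determined by its hidden blocks, so every conditional fibre is a point inside a slice of size `2^{K·#C1}` — and
then claim (a) itself, `Ej_delta_le`: the bits `c_j` of the template after `k` stages are `k` independent
`t*/2^{b}`-coins (a counting identity on the stage coins), Hoeffding's lower tail bounds the probability of
fewer than `k·t*/2^b − kc²` ones by `e^{−2kc⁴/k}`, and on the other templates the bound above applies.

No new named facts.
-/

namespace Literature.Computability.Cryptography

open Finset _root_.Computability Complexity HCProd Polynomial Real AffineStr

namespace HILL

namespace GAvg

/-- Linearity of the uniform average (sum). [folklore] -/
theorem uniformAvg_add_fun (k : ℕ) (F G : List Bool → ℝ) : uniformAvg k (fun r => F r + G r) = uniformAvg k F + uniformAvg k G := by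
  unfold uniformAvg; rw [← add_div, ← Finset.sum_add_distrib]

/-- A tuple of blocks as an `ℕ`-indexed family (empty beyond the tuple). [folklore] -/
def extN {t m : ℕ} (g : Fin t → List.Vector Bool m) : ℕ → List Bool := fun i => if h : i < t then (g ⟨i, h⟩).toList else []

/-- Value of `extN` inside the range. [folklore] -/
theorem extN_of_lt {t m : ℕ} (g : Fin t → List.Vector Bool m) {i : ℕ} (hi : i < t) : extN g i = (g ⟨i, hi⟩).toList := by
  simp [extN, hi]

/-- **Coin strings as `ℕ`-indexed block families.** [folklore] -/
theorem uniformAvg_blocks_nat (t m : ℕ) (Φ : (ℕ → List Bool) → ℝ) :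
    uniformAvg (t * m) (fun r => Φ fun i => Greedy.blkL m i r) = (∑ g : Fin t → List.Vector Bool m, Φ (extN g)) / 2 ^ (t * m) := by
  have h := uniformAvg_blocks t m (fun gL => Φ fun i => if h : i < t then gL ⟨i, h⟩ else [])
  dsimp only at h
  show _ = (∑ g : Fin t → List.Vector Bool m, Φ fun i => if h : i < t then (g ⟨i, h⟩).toList else []) / 2 ^ (t * m)
  rw [← h]
  refine uniformAvg_congr fun r hr => congrArg Φ (funext fun i => ?_)
  by_cases hi : i < t
  · rw [dif_pos hi]
  · rw [dif_neg hi, Greedy.blkL, List.drop_eq_nil_of_le (by rw [hr]; exact (Nat.mul_le_mul_right m (not_lt.1 hi))), List.take_nil]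

end GAvg

open GAvg

namespace GH

namespace Params

variable (P : Params) (f : List Bool → List Bool) (A : RandAlg (List Bool) Bool) (N t : ℕ) (τ : List (List Bool × Bool))

/-! ### The samplers as functions of block families; the acceptance probabilities as sums -/

/-- The public parts as a function of the `ℕ`-indexed position coins. [folklore] -/
noncomputable def pubsN (γ : ℕ → List Bool) : List Bool := ((List.range (P.kk N)).map fun i => posPub f N τ false [] i (γ i)).flatten

/-- The blocks as a function of the `ℕ`-indexed position coins. [folklore] -/
def blocksN (γ : ℕ → List Bool) : List Bool := ((List.range (P.kk N)).map fun i => posBlk N τ false [] i (γ i)).flatten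

/-- The acceptance indicator of a `𝒟`-run, as a function of (key, position coins, `A`'s coins). [folklore] -/
noncomputable def FD (U : List Bool) (γ : ℕ → List Bool) (rA : List Bool) : ℝ :=
  Greedy.ind (A.run (boolPair (unaryEncodeNat N) (hashStr (P.kk N * kL N) (P.mlen N t) U (P.blocksN N τ γ) ++ P.pubsN f N τ γ ++ U)) rA = true)

/-- The acceptance indicator of an `ℰ`-run. [folklore] -/
noncomputable def FE (Z U : List Bool) (γ : ℕ → List Bool) (rA : List Bool) : ℝ :=
  Greedy.ind (A.run (boolPair (unaryEncodeNat N) (Z ++ P.pubsN f N τ γ ++ U)) rA = true)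

variable {P f A N t τ}

/-- `pubs` through `pubsN`. [folklore] -/
theorem pubs_eq_pubsN (pcs : List Bool) : P.pubs f N τ false [] pcs = P.pubsN f N τ (fun i => Greedy.blkL (cP N) i pcs) := rfl

/-- `blocks` through `blocksN`. [folklore] -/
theorem blocks_eq_blocksN (pcs : List Bool) : P.blocks N τ false [] pcs = P.blocksN N τ (fun i => Greedy.blkL (cP N) i pcs) := rfl

/-- **`Pr[A(𝒟^{(τ)}) = 1]` as a normalised sum** over position-coin tuples, keys and `A`'s coins. [folklore] -/
theorem accD_eq_sum : P.accD f A N t τ =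
    (∑ g : Fin (P.kk N) → List.Vector Bool (cP N), ∑ U : List.Vector Bool (P.uLen N t), ∑ rA : List.Vector Bool (P.κA A N t),
      P.FD f A N t τ U.toList (extN g) rA.toList) / (2 ^ (P.kk N * cP N) * 2 ^ P.uLen N t * 2 ^ P.κA A N t) := by
  have inner : ∀ pcs : List Bool, pcs.length = P.kk N * cP N →
      uniformAvg (P.uLen N t + P.κA A N t) (fun w => Greedy.ind (P.runD f A N t τ false [] (pcs ++ w) = true)) =
        uniformAvg (P.uLen N t) fun U => uniformAvg (P.κA A N t) fun rA => P.FD f A N t τ U (fun i => Greedy.blkL (cP N) i pcs) rA := by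
    intro pcs hp
    rw [uniformAvg_append]
    refine uniformAvg_congr fun U hU => uniformAvg_congr fun rA _ => ?_
    have hdrop : (pcs ++ (U ++ rA)).drop (P.kk N * cP N + P.uLen N t) = rA := by rw [← List.drop_drop, List.drop_left' hp, List.drop_left' hU]
    rw [runD, hdrop, List.take_left' hp, List.drop_left' hp, List.take_left' hU, FD, Dsample, pubs_eq_pubsN, blocks_eq_blocksN]
  have e3 := uniformAvg_blocks_nat (P.kk N) (cP N) (fun γ => uniformAvg (P.uLen N t) fun U => uniformAvg (P.κA A N t) fun rA => P.FD f A N t τ U γ rA)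
  rw [accD, dTot, Nat.add_assoc, uniformAvg_append, uniformAvg_congr fun pcs hp => inner pcs hp, e3]
  simp only [uniformAvg, Finset.sum_div]
  refine Finset.sum_congr rfl fun g _ => Finset.sum_congr rfl fun U _ => Finset.sum_congr rfl fun rA _ => ?_
  field_simp

/-- **`Pr[A(ℰ^{(τ)}) = 1]` as a normalised sum.** [folklore] -/
theorem accE_eq_sum : P.accE f A N t τ =
    (∑ g : Fin (P.kk N) → List.Vector Bool (cP N), ∑ U : List.Vector Bool (P.uLen N t), ∑ Z : List.Vector Bool (P.mlen N t),
      ∑ rA : List.Vector Bool (P.κA A N t), P.FE f A N τ Z.toList U.toList (extN g) rA.toList) /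
        (2 ^ (P.kk N * cP N) * 2 ^ P.uLen N t * 2 ^ P.mlen N t * 2 ^ P.κA A N t) := by
  have inner : ∀ pcs : List Bool, pcs.length = P.kk N * cP N →
      uniformAvg (P.uLen N t + (P.mlen N t + P.κA A N t)) (fun w => Greedy.ind (P.runE f A N t τ false [] (pcs ++ w) = true)) =
        uniformAvg (P.uLen N t) fun U => uniformAvg (P.mlen N t) fun Z => uniformAvg (P.κA A N t) fun rA =>
          P.FE f A N τ Z U (fun i => Greedy.blkL (cP N) i pcs) rA := by
    intro pcs hp
    rw [uniformAvg_append]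
    refine uniformAvg_congr fun U hU => ?_
    rw [uniformAvg_append]
    refine uniformAvg_congr fun Z hZ => uniformAvg_congr fun rA _ => ?_
    have hdrop1 : (pcs ++ (U ++ (Z ++ rA))).drop (P.kk N * cP N + P.uLen N t) = Z ++ rA := by
      rw [← List.drop_drop, List.drop_left' hp, List.drop_left' hU]
    have hdrop2 : (pcs ++ (U ++ (Z ++ rA))).drop (P.kk N * cP N + P.uLen N t + P.mlen N t) = rA := by
      rw [← List.drop_drop, hdrop1, List.drop_left' hZ]
    rw [runE, hdrop2, hdrop1, List.take_left' hp, List.drop_left' hp, List.take_left' hU, List.take_left' hZ, FE, Esample, pubs_eq_pubsN]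
  have e3 := uniformAvg_blocks_nat (P.kk N) (cP N) (fun γ => uniformAvg (P.uLen N t) fun U => uniformAvg (P.mlen N t) fun Z =>
    uniformAvg (P.κA A N t) fun rA => P.FE f A N τ Z U γ rA)
  rw [accE, eTot, show P.kk N * cP N + P.uLen N t + P.mlen N t + P.κA A N t = P.kk N * cP N + (P.uLen N t + (P.mlen N t + P.κA A N t)) by ring,
    uniformAvg_append, uniformAvg_congr fun pcs hp => inner pcs hp, e3]
  simp only [uniformAvg, Finset.sum_div]
  refine Finset.sum_congr rfl fun g _ => Finset.sum_congr rfl fun U _ => Finset.sum_congr rfl fun Z _ => Finset.sum_congr rfl fun rA _ => ?_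
  field_simp

/-! ### The hidden slots and the side information -/

variable (P N τ) in
/-- **The positions fixed with `c_j = 1`** (those whose block is a fresh uniform `u_j`). [cite: HastadImpagliazzoLevinLuby1999, Lemma 6.3.2 (proof of (a): Σ_j c_j)] -/
def C1 : Finset (Fin (P.kk N)) := Finset.univ.filter fun j => (j : ℕ) < τ.length ∧ (τ.getD j ([], false)).2 = true

/-- The length of the non-`u` part of a position's coins. [folklore] -/
def bodyLen (N : ℕ) : ℕ := N + rlen N + kL N * N

/-- `cP = bodyLen + K`. [folklore] -/
theorem cP_eq (N : ℕ) : cP N = bodyLen N + kL N := rfl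

variable (N) in
/-- **Erasing the hidden slot**: the last `K` bits of a position's coins are zeroed. [folklore] -/
def eraseU (b : List.Vector Bool (cP N)) : List.Vector Bool (cP N) :=
  ⟨b.toList.take (bodyLen N) ++ List.replicate (kL N) false, by
    rw [List.length_append, List.length_take, List.Vector.toList_length, List.length_replicate, cP_eq, min_eq_left (Nat.le_add_right _ _)]⟩

variable (P A N t τ) in
/-- **The side information**: every coin except the hidden slots of the `C1` positions. [folklore] -/
def zSide (w : (Fin (P.kk N) → List.Vector Bool (cP N)) × List.Vector Bool (P.κA A N t)) :
    (Fin (P.kk N) → List.Vector Bool (cP N)) × List.Vector Bool (P.κA A N t) :=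
  (fun j => if j ∈ P.C1 N τ then eraseU N (w.1 j) else w.1 j, w.2)

/-- Inside the range `extN g i` is a full position block. [folklore] -/
theorem length_extN {N kk i : ℕ} (g : Fin kk → List.Vector Bool (cP N)) (hi : i < kk) : (extN g i).length = cP N := by
  rw [extN_of_lt g hi, List.Vector.toList_length]

/-- The blocks have length `k·K`. [folklore] -/
theorem length_blocksN (g : Fin (P.kk N) → List.Vector Bool (cP N)) : (P.blocksN N τ (extN g)).length = P.kk N * kL N :=
  length_flatten_map_range fun i hi => length_posBlk (fun h => absurd h Bool.false_ne_true) i (length_extN g hi)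

variable (P N τ) in
/-- **The hash input** (the blocks) as a vector. [folklore] -/
def xBlocks (g : Fin (P.kk N) → List.Vector Bool (cP N)) : List.Vector Bool (P.kk N * kL N) := ⟨P.blocksN N τ (extN g), length_blocksN g⟩

variable (P f A N t τ) in
/-- **The test**: `A`'s acceptance of `hash value ‖ pubs ‖ key`, the public parts read off the side information. [folklore] -/
noncomputable def Ftest (c : (Fin (P.kk N) → List.Vector Bool (cP N)) × List.Vector Bool (P.κA A N t))
    (p : List.Vector Bool (P.uLen N t) × (Fin (P.mlen N t) → ZMod 2)) : ℝ :=
  Greedy.ind (A.run (boolPair (unaryEncodeNat N) (encZ (P.mlen N t) p.2 ++ P.pubsN f N τ (extN c.1) ++ p.1.toList)) c.2.toList = true)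

/-- The randomness and the GL seed of an erased block are unchanged. [folklore] -/
theorem slices_eraseU (b : List.Vector Bool (cP N)) : pcR N (eraseU N b).toList = pcR N b.toList ∧ pcS N (eraseU N b).toList = pcS N b.toList := by
  have hlen : (b.toList.take (bodyLen N)).length = bodyLen N := by
    rw [List.length_take, List.Vector.toList_length, cP_eq, min_eq_left (Nat.le_add_right _ _)]
  constructor
  · show ((b.toList.take (bodyLen N) ++ List.replicate (kL N) false).drop N).take (rlen N) = (b.toList.drop N).take (rlen N)
    rw [List.drop_append_of_le_length (by rw [hlen]; unfold bodyLen; omega), List.take_append_of_le_length (by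
      rw [List.length_drop, hlen]; unfold bodyLen; omega), List.drop_take, List.take_take, min_eq_left (by unfold bodyLen; omega)]
  · show ((b.toList.take (bodyLen N) ++ List.replicate (kL N) false).drop (N + rlen N)).take (kL N * N) = (b.toList.drop (N + rlen N)).take (kL N * N)
    rw [List.drop_append_of_le_length (by rw [hlen]; unfold bodyLen; omega), List.take_append_of_le_length (by
      rw [List.length_drop, hlen]; unfold bodyLen; omega), List.drop_take, List.take_take, min_eq_left (by unfold bodyLen; omega)]

/-- `C1` positions are fixed positions. [folklore] -/
theorem mem_C1 {j : Fin (P.kk N)} : j ∈ P.C1 N τ ↔ (j : ℕ) < τ.length ∧ (τ.getD j ([], false)).2 = true := by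
  simp [C1]

/-- At a fixed position the public part does not read the hidden slot. [folklore] -/
theorem posPub_eraseU {j : ℕ} (hj : j < τ.length) (b : List.Vector Bool (cP N)) :
    posPub f N τ false [] j (eraseU N b).toList = posPub f N τ false [] j b.toList := by
  obtain ⟨h1, h2⟩ := slices_eraseU (N := N) b
  unfold posPub
  rw [if_pos hj, if_pos hj, h1, h2]

/-- **The public parts are a function of the side information.** [folklore] -/
theorem pubsN_zSide (w : (Fin (P.kk N) → List.Vector Bool (cP N)) × List.Vector Bool (P.κA A N t)) :
    P.pubsN f N τ (extN (P.zSide A N t τ w).1) = P.pubsN f N τ (extN w.1) := by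
  unfold pubsN
  refine congrArg List.flatten (List.map_congr_left fun i hi => ?_)
  have hi' := List.mem_range.1 hi
  rw [extN_of_lt _ hi', extN_of_lt _ hi']
  show posPub f N τ false [] i (if (⟨i, hi'⟩ : Fin (P.kk N)) ∈ P.C1 N τ then eraseU N (w.1 ⟨i, hi'⟩) else w.1 ⟨i, hi'⟩).toList = _
  split_ifs with h
  · exact posPub_eraseU (mem_C1.1 h).1 _
  · rfl

/-- **On the real pair the test is the `𝒟`-run's acceptance.** [folklore] -/
theorem Ftest_real (w : (Fin (P.kk N) → List.Vector Bool (cP N)) × List.Vector Bool (P.κA A N t)) (U : List.Vector Bool (P.uLen N t)) :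
    P.Ftest f A N t τ (P.zSide A N t τ w) (U, hashV (P.kk N * kL N) (P.mlen N t) U.toList (P.xBlocks N τ w.1)) = P.FD f A N t τ U.toList (extN w.1) w.2.toList := by
  rw [Ftest, FD, ← hashStr_toList, pubsN_zSide]
  rfl

/-- **Summed over the hash values the test is the `ℰ`-run's acceptance.** [folklore] -/
theorem sum_Ftest_ideal (w : (Fin (P.kk N) → List.Vector Bool (cP N)) × List.Vector Bool (P.κA A N t)) (U : List.Vector Bool (P.uLen N t)) :
    ∑ u : Fin (P.mlen N t) → ZMod 2, P.Ftest f A N t τ (P.zSide A N t τ w) (U, u) = ∑ Z : List.Vector Bool (P.mlen N t), P.FE f A N τ Z.toList U.toList (extN w.1) w.2.toList := by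
  rw [GLEns.sum_vector_eq_sum_bvec (P.mlen N t) (fun Z => P.FE f A N τ Z U.toList (extN w.1) w.2.toList)]
  refine Finset.sum_congr rfl fun u _ => ?_
  rw [Ftest, FE, pubsN_zSide]
  rfl

/-! ### The fibres of the side information -/

/-- Block `i` of a concatenation of `k` blocks of length `L`. [folklore] -/
theorem blkL_flatten {k L : ℕ} {F : ℕ → List Bool} (h : ∀ i < k, (F i).length = L) {i : ℕ} (hi : i < k) :
    Greedy.blkL L i (((List.range k).map F).flatten) = F i := by
  induction k with
  | zero => exact absurd hi (Nat.not_lt_zero _)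
  | succ k ih =>
    have hk : (((List.range k).map F).flatten).length = k * L := length_flatten_map_range fun j hj => h j (Nat.lt_succ_of_lt hj)
    rw [List.range_succ, List.map_append, List.flatten_append, List.map_singleton, List.flatten_singleton, Greedy.blkL]
    rcases Nat.lt_succ_iff_lt_or_eq.1 hi with hlt | heq
    · have hiL : i * L + L ≤ k * L := by have := Nat.mul_le_mul_right L hlt; rw [Nat.succ_mul] at this; omega
      rw [List.drop_append_of_le_length (by rw [hk]; omega), List.take_append_of_le_length (by rw [List.length_drop, hk]; omega)]
      exact ih (fun j hj => h j (Nat.lt_succ_of_lt hj)) hlt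
    · subst heq
      rw [List.drop_left' hk, List.take_of_length_le (h i hi).le]

/-- The hidden slot of a `C1` position is block `j` of the hash input. [folklore] -/
theorem pcU_eq_blkL_xBlocks (g : Fin (P.kk N) → List.Vector Bool (cP N)) {j : Fin (P.kk N)} (hj : j ∈ P.C1 N τ) :
    pcU N (g j).toList = Greedy.blkL (kL N) j (P.xBlocks N τ g).toList := by
  obtain ⟨h1, h2⟩ := mem_C1.1 hj
  show _ = Greedy.blkL (kL N) j (P.blocksN N τ (extN g))
  rw [blocksN, blkL_flatten (fun i hi => length_posBlk (fun h => absurd h Bool.false_ne_true) i (length_extN g hi)) j.isLt,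
    extN_of_lt g j.isLt, posBlk, if_pos h1, if_pos h2]

/-- `pcU` is the suffix after the body. [folklore] -/
theorem pcU_eq_drop (b : List.Vector Bool (cP N)) : pcU N b.toList = b.toList.drop (bodyLen N) := by
  unfold pcU bodyLen
  rw [List.take_of_length_le]
  rw [List.length_drop, List.Vector.toList_length, cP_eq, bodyLen]; omega

/-- Erasure determines the body. [folklore] -/
theorem take_eq_of_eraseU_eq {b b' : List.Vector Bool (cP N)} (h : eraseU N b = eraseU N b') : b.toList.take (bodyLen N) = b'.toList.take (bodyLen N) := by
  have h' := congrArg List.Vector.toList h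
  simp only [eraseU, List.Vector.toList_mk] at h'
  exact List.append_inj_left' h' rfl

/-- **Each fibre of (side information, hash input) is a point.** [folklore] -/
theorem eq_of_zSide_eq_of_xBlocks_eq {w w' : (Fin (P.kk N) → List.Vector Bool (cP N)) × List.Vector Bool (P.κA A N t)}
    (hz : P.zSide A N t τ w = P.zSide A N t τ w') (hx : P.xBlocks N τ w.1 = P.xBlocks N τ w'.1) : w = w' := by
  have hz' := hz
  simp only [zSide, Prod.mk.injEq] at hz'
  obtain ⟨hg, h2⟩ := hz'
  refine Prod.ext (funext fun j => ?_) h2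
  have hj := congrFun hg j
  by_cases hC : j ∈ P.C1 N τ
  · rw [if_pos hC, if_pos hC] at hj
    have hbody := take_eq_of_eraseU_eq hj
    have hslot : (w.1 j).toList.drop (bodyLen N) = (w'.1 j).toList.drop (bodyLen N) := by
      rw [← pcU_eq_drop, ← pcU_eq_drop, pcU_eq_blkL_xBlocks w.1 hC, pcU_eq_blkL_xBlocks w'.1 hC, hx]
    apply List.Vector.toList_injective
    rw [← List.take_append_drop (bodyLen N) (w.1 j).toList, hbody, hslot, List.take_append_drop]
  · rw [if_neg hC, if_neg hC] at hj
    exact hj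

/-- **The slice of an erased block has `2^K` elements.** [folklore] -/
theorem card_filter_eraseU_eq (b₀ : List.Vector Bool (cP N)) :
    ((Finset.univ : Finset (List.Vector Bool (cP N))).filter fun b => eraseU N b = eraseU N b₀).card = 2 ^ kL N := by
  classical
  let e : List.Vector Bool (cP N) ≃ List.Vector Bool (bodyLen N) × List.Vector Bool (kL N) := vecSplitEquiv (bodyLen N) (kL N)
  have key : ∀ b : List.Vector Bool (cP N), eraseU N b = eraseU N b₀ ↔ (e b).1 = (e b₀).1 := by
    intro b
    constructor
    · intro h
      exact Subtype.ext (take_eq_of_eraseU_eq h)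
    · intro h
      have h' : b.toList.take (bodyLen N) = b₀.toList.take (bodyLen N) := congrArg List.Vector.toList h
      apply Subtype.ext
      show b.toList.take (bodyLen N) ++ _ = b₀.toList.take (bodyLen N) ++ _
      rw [h']
  rw [Finset.card_equiv e (t := ({(e b₀).1} : Finset _) ×ˢ (Finset.univ : Finset (List.Vector Bool (kL N)))) (fun b => by
    simp only [Finset.mem_filter, Finset.mem_univ, true_and, Finset.mem_product, Finset.mem_singleton, and_true, key])]
  rw [Finset.card_product, Finset.card_singleton, one_mul, Finset.card_univ, card_vector, Fintype.card_bool]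

/-- **The slice of the side information through `w₀` has exactly `2^{K·#C1}` elements.** [folklore] -/
theorem card_slice (w₀ : (Fin (P.kk N) → List.Vector Bool (cP N)) × List.Vector Bool (P.κA A N t)) :
    ((Finset.univ.filter fun w => P.zSide A N t τ w = P.zSide A N t τ w₀).card : ℕ) = 2 ^ (kL N * (P.C1 N τ).card) := by
  classical
  set S : Fin (P.kk N) → Finset (List.Vector Bool (cP N)) := fun j =>
    Finset.univ.filter fun b => if j ∈ P.C1 N τ then eraseU N b = eraseU N (w₀.1 j) else b = w₀.1 j with hS
  have hset : (Finset.univ.filter fun w => P.zSide A N t τ w = P.zSide A N t τ w₀) = Fintype.piFinset S ×ˢ {w₀.2} := by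
    ext w
    simp only [Finset.mem_filter, Finset.mem_univ, true_and, Finset.mem_product, Fintype.mem_piFinset, Finset.mem_singleton, hS,
      zSide, Prod.mk.injEq]
    constructor
    · rintro ⟨hg, h2⟩
      refine ⟨fun j => ?_, h2⟩
      have hj := congrFun hg j
      split_ifs at hj ⊢ with hC <;> exact hj
    · rintro ⟨hg, h2⟩
      refine ⟨funext fun j => ?_, h2⟩
      have hj := hg j
      split_ifs at hj ⊢ with hC <;> exact hj
  rw [hset, Finset.card_product, Finset.card_singleton, mul_one, Fintype.card_piFinset]
  have hSj : ∀ j, (S j).card = if j ∈ P.C1 N τ then 2 ^ kL N else 1 := by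
    intro j
    simp only [hS]
    split_ifs with hC
    · exact card_filter_eraseU_eq _
    · rw [Finset.filter_eq', if_pos (Finset.mem_univ _), Finset.card_singleton]
  simp only [hSj]
  rw [Finset.prod_ite_mem_eq, Finset.prod_const, ← pow_mul]

/-- **The fibre bound of the generalized Leftover Hash Lemma** with min-entropy `K·#C1`. [folklore] -/
theorem fibre_bound (c : (Fin (P.kk N) → List.Vector Bool (cP N)) × List.Vector Bool (P.κA A N t)) (a : List.Vector Bool (P.kk N * kL N)) :
    (Finset.univ.filter fun w => P.zSide A N t τ w = c ∧ P.xBlocks N τ w.1 = a).card * 2 ^ (kL N * (P.C1 N τ).card) ≤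
      (Finset.univ.filter fun w => P.zSide A N t τ w = c).card := by
  classical
  by_cases hne : (Finset.univ.filter fun w => P.zSide A N t τ w = c).Nonempty
  · obtain ⟨w₀, hw₀⟩ := hne
    have hc : P.zSide A N t τ w₀ = c := (Finset.mem_filter.1 hw₀).2
    rw [← hc, card_slice w₀]
    have h1 : (Finset.univ.filter fun w => P.zSide A N t τ w = P.zSide A N t τ w₀ ∧ P.xBlocks N τ w.1 = a).card ≤ 1 := by
      refine Finset.card_le_one.2 fun w hw w' hw' => ?_
      obtain ⟨hz, hx⟩ := (Finset.mem_filter.1 hw).2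
      obtain ⟨hz', hx'⟩ := (Finset.mem_filter.1 hw').2
      exact eq_of_zSide_eq_of_xBlocks_eq (hz.trans hz'.symm) (hx.trans hx'.symm)
    calc _ ≤ 1 * 2 ^ (kL N * (P.C1 N τ).card) := Nat.mul_le_mul_right _ h1
      _ = _ := one_mul _
  · rw [Finset.not_nonempty_iff_eq_empty] at hne
    have h0 : (Finset.univ.filter fun w => P.zSide A N t τ w = c ∧ P.xBlocks N τ w.1 = a) = ∅ := by
      rw [Finset.eq_empty_iff_forall_notMem] at hne ⊢
      intro w hw
      exact hne w (Finset.mem_filter.2 ⟨Finset.mem_univ _, (Finset.mem_filter.1 hw).2.1⟩)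
    rw [h0, hne]
    simp

/-! ### Claim (a), pointwise: many hidden bits make the samplers close -/

set_option maxHeartbeats 800000 in
/-- **The Leftover-Hash bound**: `|δ^{(τ)}| ≤ ½ √(2^{m} / 2^{K·#C1(τ)})`. [cite: HastadImpagliazzoLevinLuby1999, Lemma 6.3.2 (proof of (a): "applying Lemma 4.5.1, L₁(𝒟^{(kₙ)}, ℰ^{(kₙ)}) ≤ 2^{−n}")] -/
theorem abs_delta_le_sqrt : |P.delta f A N t τ| ≤ 2⁻¹ * Real.sqrt (2 ^ P.mlen N t / 2 ^ (kL N * (P.C1 N τ).card)) := by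
  classical
  have hK : LeftoverHash.IsPairwiseIndep (Finset.univ : Finset (List.Vector Bool (P.uLen N t)))
      (fun U x => hashV (P.kk N * kL N) (P.mlen N t) U.toList x) (Finset.univ : Finset (List.Vector Bool (P.kk N * kL N))) :=
    isPairwiseIndep_hashV (by rw [uLen, mul_comm]) _
  have hKne : (Finset.univ : Finset (List.Vector Bool (P.uLen N t))).Nonempty := Finset.univ_nonempty
  have hW : (Finset.univ : Finset ((Fin (P.kk N) → List.Vector Bool (cP N)) × List.Vector Bool (P.κA A N t))).Nonempty := Finset.univ_nonempty
  have h := LeftoverHash.leftoverHash_cond_minEntropy_test hKne hK hW (z := P.zSide A N t τ) (x := fun w => P.xBlocks N τ w.1)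
    (fun w _ => Finset.mem_univ _) (k := kL N * (P.C1 N τ).card) (fun c a => fibre_bound c a) (P.Ftest f A N t τ)
    (fun _ _ => Greedy.ind_nonneg _) (fun _ _ => by unfold Ftest Greedy.ind; split_ifs <;> norm_num)
  -- identify the two averages
  have hγ : (Fintype.card (Fin (P.mlen N t) → ZMod 2) : ℝ) = 2 ^ P.mlen N t := by
    rw [Fintype.card_fun, Fintype.card_fin, ZMod.card]; push_cast; ring
  have hKc : ((Finset.univ : Finset (List.Vector Bool (P.uLen N t))).card : ℝ) = 2 ^ P.uLen N t := by
    rw [Finset.card_univ, card_vector, Fintype.card_bool]; push_cast; ring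
  have hWc : ((Finset.univ : Finset ((Fin (P.kk N) → List.Vector Bool (cP N)) × List.Vector Bool (P.κA A N t))).card : ℝ) =
      2 ^ (P.kk N * cP N) * 2 ^ P.κA A N t := by
    rw [Finset.card_univ, Fintype.card_prod, Fintype.card_fun, Fintype.card_fin, card_vector, card_vector, Fintype.card_bool]
    push_cast
    rw [← pow_mul, mul_comm (cP N)]
  have hD : (∑ U : List.Vector Bool (P.uLen N t), ∑ w : (Fin (P.kk N) → List.Vector Bool (cP N)) × List.Vector Bool (P.κA A N t),
      P.Ftest f A N t τ (P.zSide A N t τ w) (U, hashV (P.kk N * kL N) (P.mlen N t) U.toList (P.xBlocks N τ w.1))) /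
        ((Finset.univ : Finset (List.Vector Bool (P.uLen N t))).card * (Finset.univ : Finset ((Fin (P.kk N) → List.Vector Bool (cP N)) × List.Vector Bool (P.κA A N t))).card) =
      P.accD f A N t τ := by
    rw [accD_eq_sum, hKc, hWc]
    simp only [Ftest_real, Fintype.sum_prod_type]
    rw [Finset.sum_comm]
    congr 1
    ring
  have hE : (∑ U : List.Vector Bool (P.uLen N t), ∑ w : (Fin (P.kk N) → List.Vector Bool (cP N)) × List.Vector Bool (P.κA A N t),
      ∑ u : Fin (P.mlen N t) → ZMod 2, P.Ftest f A N t τ (P.zSide A N t τ w) (U, u)) /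
        ((Finset.univ : Finset (List.Vector Bool (P.uLen N t))).card * (Finset.univ : Finset ((Fin (P.kk N) → List.Vector Bool (cP N)) × List.Vector Bool (P.κA A N t))).card *
          Fintype.card (Fin (P.mlen N t) → ZMod 2)) =
      P.accE f A N t τ := by
    rw [accE_eq_sum, hKc, hWc, hγ]
    simp only [sum_Ftest_ideal, Fintype.sum_prod_type]
    rw [Finset.sum_comm]
    have hsw : ∀ g : Fin (P.kk N) → List.Vector Bool (cP N), ∀ U : List.Vector Bool (P.uLen N t),
        ∑ rA : List.Vector Bool (P.κA A N t), ∑ Z : List.Vector Bool (P.mlen N t), P.FE f A N τ Z.toList U.toList (extN g) rA.toList =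
          ∑ Z : List.Vector Bool (P.mlen N t), ∑ rA : List.Vector Bool (P.κA A N t), P.FE f A N τ Z.toList U.toList (extN g) rA.toList :=
      fun g U => Finset.sum_comm
    simp only [hsw]
    congr 1
    ring
  rw [hD, hE, hγ] at h
  simpa only [delta] using h

/-- **Claim (a), pointwise**: if the hidden slots carry at least `m + 2N + 2` bits then `|δ^{(τ)}| ≤ 2^{−(N+2)}`.
[cite: HastadImpagliazzoLevinLuby1999, Lemma 6.3.2 (proof of (a))] -/
theorem abs_delta_le_of_hidden (h : P.mlen N t + 2 * N + 2 ≤ kL N * (P.C1 N τ).card) : |P.delta f A N t τ| ≤ 1 / 2 ^ (N + 2) := by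
  refine (abs_delta_le_sqrt (P := P) (f := f) (A := A) (N := N) (t := t) (τ := τ)).trans ?_
  have hle : (2 : ℝ) ^ P.mlen N t / 2 ^ (kL N * (P.C1 N τ).card) ≤ (1 / 2 ^ (N + 1)) ^ 2 := by
    rw [div_le_iff₀ (by positivity), one_div, inv_pow, ← pow_mul]
    rw [inv_mul_eq_div, le_div_iff₀ (by positivity), ← pow_add]
    exact pow_le_pow_right₀ (by norm_num) (by omega)
  have hsq : Real.sqrt (2 ^ P.mlen N t / 2 ^ (kL N * (P.C1 N τ).card)) ≤ 1 / 2 ^ (N + 1) :=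
    (Real.sqrt_le_sqrt hle).trans (le_of_eq (Real.sqrt_sq (by positivity)))
  calc 2⁻¹ * Real.sqrt (2 ^ P.mlen N t / 2 ^ (kL N * (P.C1 N τ).card)) ≤ 2⁻¹ * (1 / 2 ^ (N + 1)) :=
        mul_le_mul_of_nonneg_left hsq (by norm_num)
    _ = 1 / 2 ^ (N + 2) := by rw [pow_succ]; ring

end Params

end GH

/-! ### The Bernoulli bits of a template -/

namespace Greedy.Data

variable {N : ℕ} (Q : Data N)

/-- The template after `j` stages has `j` fixings. [folklore] -/
theorem length_templateOf : ∀ (j : ℕ) (cc : List Bool), (Q.templateOf j cc).length = j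
  | 0, _ => rfl
  | j + 1, cc => by rw [templateOf, stage, List.length_append, List.length_singleton, length_templateOf j]

/-- The Bernoulli bit only reads the first `b` coins. [folklore] -/
theorem cOf_congr {coins coins' : List Bool} (h : coins.take Q.b = coins'.take Q.b) : Q.cOf coins = Q.cOf coins' := by
  unfold cOf; rw [h]

/-- Blocks of a long prefix. [folklore] -/
theorem blkL_take_of_lt {L i j : ℕ} (hij : i < j) (cc : List Bool) : Greedy.blkL L i (cc.take (j * L)) = Greedy.blkL L i cc := by
  unfold Greedy.blkL
  rw [List.drop_take, List.take_take, min_eq_left]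
  have := Nat.mul_le_mul_right L hij; rw [Nat.succ_mul] at this; omega

/-- **The bits `c_j` of the template after `j` stages are the Bernoulli bits of the `j` stage windows.** [folklore] -/
theorem map_snd_templateOf (hb : Q.b ≤ Q.cS) : ∀ (j : ℕ) (cc : List Bool),
    (Q.templateOf j cc).map Prod.snd = (List.range j).map fun i => Q.cOf (Greedy.blkL Q.cS i cc)
  | 0, _ => rfl
  | j + 1, cc => by
    rw [templateOf, stage, List.map_append, List.map_singleton, map_snd_templateOf hb j, List.range_succ, List.map_append, List.map_singleton]
    congr 1
    · exact List.map_congr_left fun i hi => by rw [blkL_take_of_lt (List.mem_range.1 hi)]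
    · rw [choice]
      congr 1
      refine Q.cOf_congr ?_
      rw [Greedy.blkL, List.take_take, min_eq_left hb]

/-- The `i`-th bit of the template. [folklore] -/
theorem snd_getD_templateOf (hb : Q.b ≤ Q.cS) {j i : ℕ} (hi : i < j) (cc : List Bool) :
    ((Q.templateOf j cc).getD i ([], false)).2 = Q.cOf (Greedy.blkL Q.cS i cc) := by
  have h := congrArg (fun l : List Bool => l.getD i false) (Q.map_snd_templateOf hb j cc)
  rw [show false = Prod.snd (([] : List Bool), false) from rfl, List.getD_map] at h
  rw [h, List.getD_eq_getElem _ _ (by rw [List.length_map, List.length_range]; exact hi), List.getElem_map, List.getElem_range]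

/-- **The Bernoulli windows: `#{v ∈ {0,1}^{cS} : c(v) = 1} = t · 2^{cS − b}`.** [folklore] -/
theorem card_filter_cOf (ht : Q.t ≤ 2 ^ Q.b) :
    ((Finset.univ : Finset (List.Vector Bool Q.cS)).filter fun v => Q.cOf v.toList = true).card = Q.t * 2 ^ (Q.τn * (N + Q.cE)) := by
  classical
  let e : List.Vector Bool Q.cS ≃ List.Vector Bool Q.b × List.Vector Bool (Q.τn * (N + Q.cE)) := vecSplitEquiv Q.b (Q.τn * (N + Q.cE))
  have key : ∀ v : List.Vector Bool Q.cS, Q.cOf v.toList = true ↔ bitsToNat (e v).1.toList < Q.t := by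
    intro v
    simp only [cOf, decide_eq_true_eq]
    rfl
  rw [Finset.card_equiv e (t := (Finset.univ.filter fun x : List.Vector Bool Q.b => bitsToNat x.toList < Q.t) ×ˢ
      (Finset.univ : Finset (List.Vector Bool (Q.τn * (N + Q.cE))))) (fun v => by
    simp only [Finset.mem_filter, Finset.mem_univ, true_and, Finset.mem_product, and_true, key])]
  rw [Finset.card_product, card_filter_bitsToNat_lt ht, Finset.card_univ, card_vector, Fintype.card_bool]

/-- **Few ones are rare** (Hoeffding's lower tail for the `k` independent `t/2^b`-coins of the stage windows):
`Pr_cc[#{j < k : c_j = 1} ≤ k·t/2^b − a] ≤ e^{−2a²/k}`. [cite: HastadImpagliazzoLevinLuby1999, Lemma 6.3.2 (proof of (a): "applying Chernoff bounds … with probability at least 1 − 2^{−n}, Σ_j c_j ≥ kₙpₙ − kₙ^{2/3}")] -/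
theorem uniformAvg_fewOnes_le (ht : Q.t ≤ 2 ^ Q.b) {k : ℕ} (hk : 0 < k) {a : ℝ} (ha : 0 ≤ a) :
    uniformAvg (k * Q.cS) (fun cc => Greedy.ind
      ((((Finset.univ : Finset (Fin k)).filter fun j : Fin k => Q.cOf (Greedy.blkL Q.cS j cc) = true).card : ℝ) ≤ k * Q.t / 2 ^ Q.b - a)) ≤
      exp (-2 * k * (a / k) ^ 2) := by
  classical
  have hb := uniformAvg_blocks k Q.cS (fun gL => Greedy.ind
    ((((Finset.univ : Finset (Fin k)).filter fun j : Fin k => Q.cOf (gL j) = true).card : ℝ) ≤ k * Q.t / 2 ^ Q.b - a))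
  dsimp only at hb
  rw [hb]
  have hη : 0 ≤ a / k := by positivity
  have h := card_lowerDeviation_le_exp (fun v : List.Vector Bool Q.cS => Q.cOf v.toList = true) hk hη
  have hp : (((Finset.univ : Finset (List.Vector Bool Q.cS)).filter fun v => Q.cOf v.toList = true).card : ℝ) /
      Fintype.card (List.Vector Bool Q.cS) = Q.t / 2 ^ Q.b := by
    rw [card_filter_cOf Q ht, card_vector, Fintype.card_bool, cS]
    push_cast
    have h2 : (0 : ℝ) < 2 ^ Q.b := by positivity
    have h3 : (0 : ℝ) < 2 ^ (Q.τn * (N + Q.cE)) := by positivity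
    field_simp
    ring
  rw [hp] at h
  have hkη : (k : ℝ) * (a / k) = a := by field_simp
  rw [hkη] at h
  have hΩ : (Fintype.card (Fin k → List.Vector Bool Q.cS) : ℝ) = 2 ^ (k * Q.cS) := by
    rw [Fintype.card_fun, Fintype.card_fin, card_vector, Fintype.card_bool]; push_cast; rw [← pow_mul, mul_comm]
  rw [hΩ] at h
  have hpow : (0 : ℝ) < 2 ^ (k * Q.cS) := by positivity
  rw [div_le_iff₀ hpow]
  refine le_trans ?_ h
  rw [Finset.natCast_card_filter]
  refine Finset.sum_le_sum fun g _ => ?_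
  by_cases hev : (((Finset.univ : Finset (Fin k)).filter fun j : Fin k => Q.cOf (g j).toList = true).card : ℝ) ≤ k * Q.t / 2 ^ Q.b - a
  · rw [Greedy.ind_of_true hev, if_pos]
    have : (k : ℝ) * (Q.t / 2 ^ Q.b) = k * Q.t / 2 ^ Q.b := by ring
    rw [this]; linarith
  · rw [Greedy.ind_of_false hev]; split_ifs <;> norm_num

end Greedy.Data

namespace GH

namespace Params

variable {P : Params} {f : List Bool → List Bool} {A : RandAlg (List Bool) Bool} {NsP τnP : Polynomial ℕ} {ρf : ℕ → ℝ}

/-- **The hidden positions of the template after `k` stages are the `1`-windows.** [folklore] -/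
theorem card_C1_templateOf (N t : ℕ) (cc : List Bool) :
    (P.C1 N ((P.QM f A NsP τnP N t).templateOf (P.kk N) cc)).card =
      ((Finset.univ : Finset (Fin (P.kk N))).filter fun j : Fin (P.kk N) => (P.QM f A NsP τnP N t).cOf (Greedy.blkL (P.QM f A NsP τnP N t).cS j cc) = true).card := by
  have hb : (P.QM f A NsP τnP N t).b ≤ (P.QM f A NsP τnP N t).cS := Nat.le_add_right _ _
  unfold C1
  congr 1
  ext j
  simp only [Finset.mem_filter, Finset.mem_univ, true_and, Greedy.Data.length_templateOf, j.isLt,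
    Greedy.Data.snd_getD_templateOf _ hb j.isLt]

/-- **Claim (a)**: `E[δ^{(k)}] ≤ e^{−2·kc(N)} + 2^{−(N+2)}` — after `k = kc³` stages the number of hidden positions is
`≥ k t*/2^b − kc²` except with probability `e^{−2kc}` (Hoeffding), and then the hidden bits exceed `m + 2N + 2` by the
choice of `m` (hypothesis `Hm`, HILL's `mₙ = kₙpₙ − 2kₙ^{2/3}`), so the Leftover Hash Lemma applies.
[cite: HastadImpagliazzoLevinLuby1999, Lemma 6.3.2 (proof, claim (a))] -/
theorem Ej_delta_le {N : ℕ} (hkc : 1 ≤ P.kc N)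
    (Hm : (P.mlen N (tStar f N) : ℝ) + 2 * N + 2 ≤ kL N * (P.kk N * tStar f N / 2 ^ bLen N - (P.kc N : ℝ) ^ 2)) :
    (P.QD f A NsP τnP ρf N).Ej (P.kk N) (P.QD f A NsP τnP ρf N).δ ≤ exp (-2 * P.kc N) + 1 / 2 ^ (N + 2) := by
  have hkk : 0 < P.kk N := by unfold kk; exact Nat.pow_pos hkc
  have ht : (P.QM f A NsP τnP N (tStar f N)).t ≤ 2 ^ (P.QM f A NsP τnP N (tStar f N)).b := tStar_le f N
  -- the rare event
  have hfew := Greedy.Data.uniformAvg_fewOnes_le (P.QM f A NsP τnP N (tStar f N)) ht hkk (a := (P.kc N : ℝ) ^ 2) (by positivity)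
  have hexp : exp (-2 * (P.kk N : ℝ) * ((P.kc N : ℝ) ^ 2 / P.kk N) ^ 2) = exp (-2 * P.kc N) := by
    congr 1
    rw [kk]; push_cast
    have hc0 : (P.kc N : ℝ) ≠ 0 := by exact_mod_cast (by omega : P.kc N ≠ 0)
    field_simp
  rw [hexp] at hfew
  -- pointwise
  have hpt : ∀ cc : List Bool, P.delta f A N (tStar f N) ((P.QM f A NsP τnP N (tStar f N)).templateOf (P.kk N) cc) ≤
      Greedy.ind ((((Finset.univ : Finset (Fin (P.kk N))).filter fun j : Fin (P.kk N) =>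
        (P.QM f A NsP τnP N (tStar f N)).cOf (Greedy.blkL (P.QM f A NsP τnP N (tStar f N)).cS j cc) = true).card : ℝ) ≤
          P.kk N * (P.QM f A NsP τnP N (tStar f N)).t / 2 ^ (P.QM f A NsP τnP N (tStar f N)).b - (P.kc N : ℝ) ^ 2) + 1 / 2 ^ (N + 2) := by
    intro cc
    by_cases hev : (((Finset.univ : Finset (Fin (P.kk N))).filter fun j : Fin (P.kk N) =>
        (P.QM f A NsP τnP N (tStar f N)).cOf (Greedy.blkL (P.QM f A NsP τnP N (tStar f N)).cS j cc) = true).card : ℝ) ≤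
          P.kk N * (P.QM f A NsP τnP N (tStar f N)).t / 2 ^ (P.QM f A NsP τnP N (tStar f N)).b - (P.kc N : ℝ) ^ 2
    · rw [Greedy.ind_of_true hev]
      have h1 := abs_delta_le (P := P) (f := f) (A := A) N (tStar f N) ((P.QM f A NsP τnP N (tStar f N)).templateOf (P.kk N) cc)
      have : (0 : ℝ) ≤ 1 / 2 ^ (N + 2) := by positivity
      linarith [(abs_le.1 h1).2]
    · rw [Greedy.ind_of_false hev, zero_add]
      have hcard := card_C1_templateOf (P := P) (f := f) (A := A) (NsP := NsP) (τnP := τnP) N (tStar f N) cc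
      have hgt : (P.kk N : ℝ) * tStar f N / 2 ^ bLen N - (P.kc N : ℝ) ^ 2 <
          (P.C1 N ((P.QM f A NsP τnP N (tStar f N)).templateOf (P.kk N) cc)).card := by
        rw [hcard]; exact lt_of_not_ge hev
      have hK : (0 : ℝ) ≤ kL N := Nat.cast_nonneg _
      have hreal : (P.mlen N (tStar f N) : ℝ) + 2 * N + 2 ≤ kL N * (P.C1 N ((P.QM f A NsP τnP N (tStar f N)).templateOf (P.kk N) cc)).card :=
        Hm.trans (mul_le_mul_of_nonneg_left hgt.le hK)
      have hnat : P.mlen N (tStar f N) + 2 * N + 2 ≤ kL N * (P.C1 N ((P.QM f A NsP τnP N (tStar f N)).templateOf (P.kk N) cc)).card := by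
        exact_mod_cast hreal
      exact (abs_le.1 (abs_delta_le_of_hidden (P := P) (f := f) (A := A) hnat)).2
  -- average
  have hEj : (P.QD f A NsP τnP ρf N).Ej (P.kk N) (P.QD f A NsP τnP ρf N).δ =
      uniformAvg (P.kk N * (P.QM f A NsP τnP N (tStar f N)).cS) fun cc =>
        P.delta f A N (tStar f N) ((P.QM f A NsP τnP N (tStar f N)).templateOf (P.kk N) cc) := by
    rw [Greedy.Data.Ej, QD_templateOf, QD_cS]
    rfl
  rw [hEj]
  refine (uniformAvg_mono fun cc _ => hpt cc).trans ?_
  rw [uniformAvg_add_fun, uniformAvg_const]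
  exact add_le_add_left hfew _

end Params

end GH

end HILL

end Literature.Computability.Cryptography
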